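import Literature.Analysis.Fourier.LebesgueConstants
import Mathlib.Analysis.SpecialFunctions.Pow.Asymptotics
import HarnessLib

/-!
# Jackson's theorem `E_n[f] = O(n^{-α})` for `f ∈ Λ_α` and uniform convergence of `S_n[f]` (Zygmund III (13.14), II (10.3))

Topic `Literature/Analysis/Fourier`. A. Zygmund, *Trigonometric Series*, Vol. I, Ch. III §13, Theorem (13.6)/(13.8)
(Jackson: «if `f` is continuous and has modulus of continuity `ω(δ)`, then `E_n[f] ≤ B ω(2π/n)`») in the case
of the classes `Λ_α`, Theorem (13.14) with `k = 0`: «if `f ∈ Λ_α`, `0 < α ≤ 1`, then `E_n[f] = O(n^{−α})`» (13.15);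
combined with Lebesgue's inequality (13.25) (`LebesgueConstants.lean`) this gives the uniform convergence of `S[f]`
for `f ∈ Λ_α` — a case of the Dini–Lipschitz theorem, Ch. II (10.3) («if `f` is continuous and
`ω(δ) log δ → 0`, then `S[f]` converges uniformly»; Zygmund: «(13.25) shows that `S[f]` converges uniformly to
`f`. This is Theorem (10.3) of Chapter II»).

The approximating polynomials are the Jackson means `∫₀¹ J_M(x − s) f(s) ds` built on the tree's Jackson kernel
`TrigApprox.jackson M = F_M²/∫F_M²` (`FejerJacksonKernels.lean`: `jackson_nonneg`, `integral_jackson`, the tail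
bound `jackson_le_inv`, `jacksonConst_ge`), a trigonometric polynomial of degree `2M`; period `1`, conventions of
`DiniTestLocalization.lean` ∕ `LebesgueConstants.lean`.

* § 1 products of trigonometric polynomials `Σ_{|k|≤a} c_k e(kx)` (`exists_trigPoly_mul`), the Fejér and Jackson
  kernels as such polynomials (`exists_trigPoly_fejer`, `exists_trigPoly_jackson`), and the Jackson mean of `f` as a
  trigonometric polynomial of degree `2M` (`exists_trigPoly_jacksonMean`).
* § 2 kernel estimates: `jackson_le_mul_succ` (`J_M ≤ π⁴(M+1)/8`), `integral_jackson_symm` (`∫_{−½}^{½} J_M = 1`),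
  `integral_jackson_mul_rpow_le` (`∫₀^{½} J_M(t) t^α dt ≤ (1 + π⁴/128)(M+1)^{−α}`, `0 < α ≤ 1`).
* § 3 **Jackson's theorem for `Λ_α`**: `norm_jacksonMean_sub_le` and `exists_trigPoly_norm_sub_le_of_holder` — if
  `|f(x+t) − f(x)| ≤ K|t|^α` then there is a trigonometric polynomial `T` of degree `2M` with
  `sup|f − T| ≤ 2(1 + π⁴/128) K (M+1)^{−α}` ((13.15) with `k = 0`, explicit constant).
* § 4 **uniform convergence of `S_n[f]` for `f ∈ Λ_α`** (`tendstoUniformly_partialSum_of_holder`), from § 3 and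
  `norm_partialSum_sub_le_of_trigPoly` ((13.25)): `sup|S_n f − f| ≤ (2 + log(2n+1)) · O(n^{−α}) → 0`.

Everything is proved; no definitions.

## References

* A. Zygmund, *Trigonometric Series*, 3rd ed., Vol. I, CUP (2002), Ch. III §13 Theorems (13.6) ((13.7)–(13.8)),
  (13.14) ((13.15)), (13.25); Ch. II §10 Theorem (10.3) (Dini–Lipschitz).
  [cite: Zygmund2002, Vol. I, Ch. III §13 (13.6), (13.14), (13.25); Ch. II (10.3)]
-/

noncomputable section

open MeasureTheory Complex Filter Topology intervalIntegral Finset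
open scoped Real

namespace Literature.Analysis.Fourier

/-! ## § 1. Trigonometric polynomials: products, the kernels, the Jackson means -/

section trigPoly

/-- **The product of trigonometric polynomials of degrees `a` and `b` is one of degree `a + b`.**
[cite: Zygmund2002, Vol. I, Ch. I §1 (trigonometric polynomials)] -/
theorem exists_trigPoly_mul (a b : ℕ) (c d : ℤ → ℂ) :
    ∃ g : ℤ → ℂ, ∀ x : ℝ,
      (∑ j ∈ Icc (-(a : ℤ)) a, c j * TrigApprox.e (j * x)) * (∑ k ∈ Icc (-(b : ℤ)) b, d k * TrigApprox.e (k * x))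
        = ∑ l ∈ Icc (-((a + b : ℕ) : ℤ)) (a + b : ℕ), g l * TrigApprox.e (l * x) := by
  classical
  refine ⟨fun l => ∑ j ∈ Icc (-(a : ℤ)) a, ∑ k ∈ Icc (-(b : ℤ)) b, if j + k = l then c j * d k else 0, fun x => ?_⟩
  -- each term `c_j d_k e((j+k)x)` is `Σ_l [j+k=l] c_j d_k e(lx)`
  have hterm : ∀ j ∈ Icc (-(a : ℤ)) a, ∀ k ∈ Icc (-(b : ℤ)) b,
      c j * TrigApprox.e (j * x) * (d k * TrigApprox.e (k * x))
        = ∑ l ∈ Icc (-((a + b : ℕ) : ℤ)) (a + b : ℕ), (if j + k = l then c j * d k else 0) * TrigApprox.e (l * x) := by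
    intro j hj k hk
    have hmem : j + k ∈ Icc (-((a + b : ℕ) : ℤ)) (a + b : ℕ) := by
      simp only [mem_Icc, Nat.cast_add] at hj hk ⊢; omega
    simp_rw [ite_mul, zero_mul]
    rw [sum_ite_eq, if_pos hmem, show (((j + k : ℤ)) : ℝ) * x = j * x + k * x by push_cast; ring, TrigApprox.e_add]
    ring
  calc (∑ j ∈ Icc (-(a : ℤ)) a, c j * TrigApprox.e (j * x)) * (∑ k ∈ Icc (-(b : ℤ)) b, d k * TrigApprox.e (k * x))
      = ∑ j ∈ Icc (-(a : ℤ)) a, ∑ k ∈ Icc (-(b : ℤ)) b, c j * TrigApprox.e (j * x) * (d k * TrigApprox.e (k * x)) :=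
        sum_mul_sum _ _ _ _
    _ = ∑ j ∈ Icc (-(a : ℤ)) a, ∑ k ∈ Icc (-(b : ℤ)) b, ∑ l ∈ Icc (-((a + b : ℕ) : ℤ)) (a + b : ℕ),
          (if j + k = l then c j * d k else 0) * TrigApprox.e (l * x) :=
        sum_congr rfl fun j hj => sum_congr rfl fun k hk => hterm j hj k hk
    _ = ∑ j ∈ Icc (-(a : ℤ)) a, ∑ l ∈ Icc (-((a + b : ℕ) : ℤ)) (a + b : ℕ), ∑ k ∈ Icc (-(b : ℤ)) b,
          (if j + k = l then c j * d k else 0) * TrigApprox.e (l * x) :=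
        sum_congr rfl fun j _ => sum_comm
    _ = ∑ l ∈ Icc (-((a + b : ℕ) : ℤ)) (a + b : ℕ), ∑ j ∈ Icc (-(a : ℤ)) a, ∑ k ∈ Icc (-(b : ℤ)) b,
          (if j + k = l then c j * d k else 0) * TrigApprox.e (l * x) := sum_comm
    _ = ∑ l ∈ Icc (-((a + b : ℕ) : ℤ)) (a + b : ℕ),
          (∑ j ∈ Icc (-(a : ℤ)) a, ∑ k ∈ Icc (-(b : ℤ)) b, if j + k = l then c j * d k else 0) * TrigApprox.e (l * x) := by
        refine sum_congr rfl fun l _ => ?_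
        rw [sum_mul]
        refine sum_congr rfl fun j _ => ?_
        rw [sum_mul]

/-- The Fejér kernel is a trigonometric polynomial of degree `M` (in the explicit form `Σ_{|k|≤M} c_k e(kx)`).
[cite: Zygmund2002, Vol. I, Ch. III §3 (3.2) (`K_n(t) = ½ + Σ (1 − ν/(n+1)) cos νt`)] -/
theorem exists_trigPoly_fejer (M : ℕ) :
    ∃ c : ℤ → ℂ, ∀ x : ℝ, (TrigApprox.fejer M x : ℂ) = ∑ k ∈ Icc (-(M : ℤ)) M, c k * TrigApprox.e (k * x) :=
  ⟨fun k => fejerSymbol M k, fun x => fejer_eq_sum_Icc M x⟩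

/-- **The Jackson kernel `J_M = F_M²/∫F_M²` is a trigonometric polynomial of degree `2M`.**
[cite: Zygmund2002, Vol. I, Ch. III §13 (the Jackson polynomials); tree `TrigApprox.jackson` (Travaglini §7.1 (7.3))] -/
theorem exists_trigPoly_jackson (M : ℕ) :
    ∃ c : ℤ → ℂ, ∀ x : ℝ, (TrigApprox.jackson M x : ℂ) = ∑ k ∈ Icc (-((M + M : ℕ) : ℤ)) (M + M : ℕ), c k * TrigApprox.e (k * x) := by
  obtain ⟨c, hc⟩ := exists_trigPoly_fejer M
  obtain ⟨g, hg⟩ := exists_trigPoly_mul M M c c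
  refine ⟨fun k => g k / (TrigApprox.jacksonConst M : ℂ), fun x => ?_⟩
  unfold TrigApprox.jackson
  push_cast
  rw [sq, hc x, hg x, sum_div]
  refine sum_congr rfl fun k _ => ?_
  ring

/-- **The Jackson mean `∫₀¹ J_M(x − s) f(s) ds` is a trigonometric polynomial of degree `2M` in `x`** (with
coefficients `c_k f̂(k)`). [cite: Zygmund2002, Vol. I, Ch. III §13 (Jackson polynomials of `f`)] -/
theorem exists_trigPoly_jacksonMean (M : ℕ) {f : ℝ → ℂ} (hint : IntervalIntegrable f volume 0 1) :
    ∃ c : ℤ → ℂ, ∀ x : ℝ, ∫ s in (0 : ℝ)..1, (TrigApprox.jackson M (x - s) : ℂ) * f s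
      = ∑ k ∈ Icc (-((M + M : ℕ) : ℤ)) (M + M : ℕ), c k * TrigApprox.e (k * x) := by
  obtain ⟨d, hd⟩ := exists_trigPoly_jackson M
  refine ⟨fun k => d k * fourierCoeffOn zero_lt_one f k, fun x => ?_⟩
  have hcont : ∀ k : ℤ, Continuous fun s : ℝ => TrigApprox.e (-(k * s)) := by
    intro k; unfold TrigApprox.e; fun_prop
  have hi : ∀ k ∈ Icc (-((M + M : ℕ) : ℤ)) (M + M : ℕ), IntervalIntegrable
      (fun s => d k * TrigApprox.e (k * x) * (TrigApprox.e (-(k * s)) * f s)) volume 0 1 :=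
    fun k _ => (hint.continuousOn_mul (hcont k).continuousOn).const_mul _
  calc ∫ s in (0 : ℝ)..1, (TrigApprox.jackson M (x - s) : ℂ) * f s
      = ∫ s in (0 : ℝ)..1, ∑ k ∈ Icc (-((M + M : ℕ) : ℤ)) (M + M : ℕ),
          d k * TrigApprox.e (k * x) * (TrigApprox.e (-(k * s)) * f s) := by
        refine intervalIntegral.integral_congr fun s _ => ?_
        rw [hd (x - s), sum_mul]
        refine sum_congr rfl fun k _ => ?_
        rw [show (k : ℝ) * (x - s) = k * x + -(k * s) by ring, TrigApprox.e_add]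
        ring
    _ = ∑ k ∈ Icc (-((M + M : ℕ) : ℤ)) (M + M : ℕ), ∫ s in (0 : ℝ)..1,
          d k * TrigApprox.e (k * x) * (TrigApprox.e (-(k * s)) * f s) := intervalIntegral.integral_finsetSum hi
    _ = ∑ k ∈ Icc (-((M + M : ℕ) : ℤ)) (M + M : ℕ), d k * fourierCoeffOn zero_lt_one f k * TrigApprox.e (k * x) := by
        refine sum_congr rfl fun k _ => ?_
        rw [intervalIntegral.integral_const_mul, fourierCoeffOn_eq_integral_e]
        ring

end trigPoly

/-! ## § 2. Estimates for the Jackson kernel -/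

section kernel

/-- `J_M ≤ π⁴(M+1)/8` (from `F_M ≤ M+1` and `∫F_M² ≥ 8(M+1)/π⁴`). [cite: Zygmund2002, Vol. I, Ch. III §13; tree
`TrigApprox.fejer_le`, `jacksonConst_ge`] -/
theorem jackson_le_mul_succ (M : ℕ) (x : ℝ) : TrigApprox.jackson M x ≤ π ^ 4 * ((M : ℝ) + 1) / 8 := by
  have hM : (0 : ℝ) < (M : ℝ) + 1 := by positivity
  have hc := TrigApprox.jacksonConst_ge M
  have hc0 := TrigApprox.jacksonConst_pos M
  have hF := TrigApprox.fejer_le M x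
  have hF0 := TrigApprox.fejer_nonneg M x
  unfold TrigApprox.jackson
  rw [div_le_iff₀ hc0]
  have h1 : TrigApprox.fejer M x ^ 2 ≤ ((M : ℝ) + 1) ^ 2 := pow_le_pow_left₀ hF0 hF 2
  have h2 : ((M : ℝ) + 1) ^ 2 ≤ π ^ 4 * ((M : ℝ) + 1) / 8 * TrigApprox.jacksonConst M := by
    have : ((M : ℝ) + 1) ^ 2 = π ^ 4 * ((M : ℝ) + 1) / 8 * (8 * ((M : ℝ) + 1) / π ^ 4) := by
      field_simp
    rw [this]
    exact mul_le_mul_of_nonneg_left hc (by positivity)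
  exact h1.trans h2

/-- `∫_{−½}^{½} J_M = 1`. [cite: Zygmund2002, Vol. I, Ch. III §13; tree `TrigApprox.integral_jackson`] -/
theorem integral_jackson_symm (M : ℕ) : ∫ t in (-(1 / 2) : ℝ)..(1 / 2), TrigApprox.jackson M t = 1 := by
  have hper : Function.Periodic (TrigApprox.jackson M) 1 := fun t => by
    simpa using TrigApprox.jackson_add_int M t 1
  have h := hper.intervalIntegral_add_eq (-(1 / 2)) 0
  rw [zero_add, TrigApprox.integral_jackson, show (-(1 / 2) : ℝ) + 1 = 1 / 2 by norm_num] at h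
  exact h

/-- `∫₀^{a} J_M ≤ 1` for `0 ≤ a ≤ 1`. [folklore] -/
private theorem integral_jackson_le_one (M : ℕ) {a : ℝ} (ha0 : 0 ≤ a) (ha1 : a ≤ 1) :
    ∫ t in (0 : ℝ)..a, TrigApprox.jackson M t ≤ 1 := by
  rw [← TrigApprox.integral_jackson M]
  exact intervalIntegral.integral_mono_interval le_rfl ha0 ha1
    (Filter.Eventually.of_forall fun t => TrigApprox.jackson_nonneg M t)
    ((TrigApprox.continuous_jackson M).intervalIntegrable _ _)

/-- **The moments of the Jackson kernel**: `∫₀^{½} J_M(t) t^α dt ≤ (1 + π⁴/128) (M+1)^{−α}` for `0 < α ≤ 1`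
(split at `1/(M+1)`; `J_M ≤ 1`-mass near `0`, `J_M(t) ≤ π⁴/(128(M+1)³t⁴)` away from `0`).
[cite: Zygmund2002, Vol. I, Ch. III §13 (proof of (13.6): the kernel moments)] -/
theorem integral_jackson_mul_rpow_le (M : ℕ) {α : ℝ} (hα0 : 0 < α) (hα1 : α ≤ 1) :
    ∫ t in (0 : ℝ)..(1 / 2), TrigApprox.jackson M t * t ^ α ≤ (1 + π ^ 4 / 128) * ((M : ℝ) + 1) ^ (-α) := by
  have hM : (0 : ℝ) < (M : ℝ) + 1 := by positivity
  set δ : ℝ := 1 / ((M : ℝ) + 1) with hδ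
  have hδpos : 0 < δ := by positivity
  have hδpow : ((M : ℝ) + 1) ^ (-α) = δ ^ α := by
    rw [hδ, one_div, Real.inv_rpow hM.le, Real.rpow_neg hM.le]
  have hJc : Continuous (TrigApprox.jackson M) := TrigApprox.continuous_jackson M
  have hJi : ∀ a b : ℝ, IntervalIntegrable (fun t => TrigApprox.jackson M t * t ^ α) volume a b := fun a b =>
    (hJc.mul (Real.continuous_rpow_const hα0.le)).intervalIntegrable _ _
  -- near `0`: `∫₀^{a} J_M t^α ≤ a^α ∫₀^{a} J_M ≤ a^α` for `0 ≤ a ≤ ½`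
  have hnear : ∀ a : ℝ, 0 ≤ a → a ≤ 1 / 2 → ∫ t in (0 : ℝ)..a, TrigApprox.jackson M t * t ^ α ≤ a ^ α := by
    intro a ha0 ha1
    calc ∫ t in (0 : ℝ)..a, TrigApprox.jackson M t * t ^ α ≤ ∫ t in (0 : ℝ)..a, TrigApprox.jackson M t * a ^ α := by
          refine intervalIntegral.integral_mono_on ha0 (hJi 0 a) ((hJc.mul continuous_const).intervalIntegrable _ _)
            fun t ht => ?_
          exact mul_le_mul_of_nonneg_left (Real.rpow_le_rpow ht.1 ht.2 hα0.le) (TrigApprox.jackson_nonneg M t)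
      _ = (∫ t in (0 : ℝ)..a, TrigApprox.jackson M t) * a ^ α := intervalIntegral.integral_mul_const _ _
      _ ≤ 1 * a ^ α := mul_le_mul_of_nonneg_right (integral_jackson_le_one M ha0 (by linarith)) (by positivity)
      _ = a ^ α := one_mul _
  rcases le_or_gt (1 / 2 : ℝ) δ with hbig | hsmall
  · -- `M + 1 ≤ 2`: the whole integral is `≤ (½)^α ≤ δ^α`
    have h := hnear (1 / 2) (by norm_num) le_rfl
    calc ∫ t in (0 : ℝ)..(1 / 2), TrigApprox.jackson M t * t ^ α ≤ (1 / 2 : ℝ) ^ α := h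
      _ ≤ δ ^ α := Real.rpow_le_rpow (by norm_num) hbig hα0.le
      _ ≤ (1 + π ^ 4 / 128) * ((M : ℝ) + 1) ^ (-α) := by
          rw [hδpow]
          have : 0 ≤ δ ^ α := by positivity
          nlinarith [Real.pi_pos, pow_pos Real.pi_pos 4]
  · -- split at `δ < ½`
    rw [← intervalIntegral.integral_add_adjacent_intervals (hJi 0 δ) (hJi δ (1 / 2))]
    have h1 : ∫ t in (0 : ℝ)..δ, TrigApprox.jackson M t * t ^ α ≤ δ ^ α := hnear δ hδpos.le hsmall.le
    -- away from `0`: `J_M(t) t^α ≤ (π⁴/(128(M+1)³)) t^{α−4}`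
    have h2 : ∫ t in δ..(1 / 2), TrigApprox.jackson M t * t ^ α ≤ π ^ 4 / 256 * δ ^ α := by
      have hfi : IntervalIntegrable (fun t : ℝ => π ^ 4 / (128 * ((M : ℝ) + 1) ^ 3) * t ^ (α - 4)) volume δ (1 / 2) := by
        refine (ContinuousOn.mul continuousOn_const ?_).intervalIntegrable
        refine ContinuousOn.rpow_const (by fun_prop) fun t ht => Or.inl ?_
        rw [Set.uIcc_of_le hsmall.le] at ht
        exact (hδpos.trans_le ht.1).ne'
      calc ∫ t in δ..(1 / 2), TrigApprox.jackson M t * t ^ α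
          ≤ ∫ t in δ..(1 / 2), π ^ 4 / (128 * ((M : ℝ) + 1) ^ 3) * t ^ (α - 4) := by
            refine intervalIntegral.integral_mono_on hsmall.le (hJi δ (1 / 2)) hfi fun t ht => ?_
            have ht0 : 0 < t := hδpos.trans_le ht.1
            have hJ := TrigApprox.jackson_le_inv M ht0.ne' (by rw [abs_of_pos ht0]; exact ht.2)
            calc TrigApprox.jackson M t * t ^ α ≤ π ^ 4 / (128 * ((M : ℝ) + 1) ^ 3 * t ^ 4) * t ^ α :=
                  mul_le_mul_of_nonneg_right hJ (by positivity)
              _ = π ^ 4 / (128 * ((M : ℝ) + 1) ^ 3) * t ^ (α - 4) := by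
                  rw [Real.rpow_sub ht0, show (4 : ℝ) = ((4 : ℕ) : ℝ) by norm_num, Real.rpow_natCast]
                  field_simp
        _ = π ^ 4 / (128 * ((M : ℝ) + 1) ^ 3) * (((1 / 2 : ℝ) ^ (α - 3) - δ ^ (α - 3)) / (α - 3)) := by
            rw [intervalIntegral.integral_const_mul, integral_rpow (Or.inr ⟨by linarith, ?_⟩),
              show α - 4 + 1 = α - 3 by ring]
            rw [Set.uIcc_of_le hsmall.le]
            exact fun h => (lt_irrefl (0 : ℝ)) (hδpos.trans_le h.1)
        _ ≤ π ^ 4 / (128 * ((M : ℝ) + 1) ^ 3) * (δ ^ (α - 3) / 2) := by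
            refine mul_le_mul_of_nonneg_left ?_ (by positivity)
            -- `((½)^{α−3} − δ^{α−3})/(α−3) = (δ^{α−3} − (½)^{α−3})/(3−α) ≤ δ^{α−3}/2`
            have hpos : 0 ≤ (1 / 2 : ℝ) ^ (α - 3) := by positivity
            have hδ3 : 0 ≤ δ ^ (α - 3) := by positivity
            have hne : α - 3 ≠ 0 := by linarith
            have hne' : 3 - α ≠ 0 := by linarith
            have hL : ((1 / 2 : ℝ) ^ (α - 3) - δ ^ (α - 3)) / (α - 3) = (δ ^ (α - 3) - (1 / 2 : ℝ) ^ (α - 3)) / (3 - α) := by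
              rw [div_eq_div_iff hne hne']
              ring
            rw [hL]
            exact div_le_div₀ hδ3 (by linarith) (by norm_num) (by linarith)
        _ = π ^ 4 / 256 * δ ^ α := by
            rw [Real.rpow_sub hδpos, show (3 : ℝ) = ((3 : ℕ) : ℝ) by norm_num, Real.rpow_natCast, hδ]
            field_simp
            ring
    calc (∫ t in (0 : ℝ)..δ, TrigApprox.jackson M t * t ^ α) + ∫ t in δ..(1 / 2), TrigApprox.jackson M t * t ^ α
        ≤ δ ^ α + π ^ 4 / 256 * δ ^ α := add_le_add h1 h2
      _ ≤ (1 + π ^ 4 / 128) * ((M : ℝ) + 1) ^ (-α) := by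
          rw [hδpow]
          have : 0 ≤ δ ^ α := by positivity
          nlinarith [pow_pos Real.pi_pos 4]

end kernel

/-! ## § 3. Jackson's theorem for the classes `Λ_α` -/

section jackson

variable {f : ℝ → ℂ}

/-- `t ↦ f(x₀ − t)` is integrable on every interval (`f` `1`-periodic, integrable over a period). [folklore] -/
private theorem intervalIntegrable_reflect_sub' (hper : Function.Periodic f 1)
    (hint : IntervalIntegrable f volume 0 1) (x₀ a b : ℝ) :
    IntervalIntegrable (fun t => f (x₀ - t)) volume a b := by
  have hp : Function.Periodic (fun t => f (x₀ - t)) 1 := by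
    intro t
    simp only
    rw [show x₀ - (t + 1) = x₀ - t - 1 by ring, hper.sub_eq]
  have h01 : IntervalIntegrable (fun t => f (x₀ - t)) volume (x₀ - 1) (x₀ - 1 + 1) := by
    have := hint.comp_sub_left x₀
    rw [sub_zero] at this
    rw [show x₀ - 1 + 1 = x₀ by ring]
    exact this.symm
  exact hp.intervalIntegrable one_ne_zero h01 _ _

/-- **Jackson's inequality for `Λ_α`** (Zygmund III (13.14)/(13.15), `k = 0`, via the Jackson means): if `f` is
`1`-periodic, integrable over a period and `|f(x + t) − f(x)| ≤ K|t|^α` for all `x, t` (`0 < α ≤ 1`), then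
`|∫₀¹ J_M(x − s) f(s) ds − f(x)| ≤ 2(1 + π⁴/128) K (M+1)^{−α}` for every `x`
(`= |∫_{−½}^{½} J_M(t)(f(x − t) − f(x)) dt| ≤ K ∫ J_M(t)|t|^α dt`). [cite: Zygmund2002, Vol. I, Ch. III §13, Theorems
(13.6) ((13.8) with `k = 0`) and (13.14) ((13.15) with `k = 0`)] -/
theorem norm_jacksonMean_sub_le (hper : Function.Periodic f 1) (hint : IntervalIntegrable f volume 0 1)
    {K α : ℝ} (hα0 : 0 < α) (hα1 : α ≤ 1) (hK : ∀ x t : ℝ, ‖f (x + t) - f x‖ ≤ K * |t| ^ α) (M : ℕ) (x : ℝ) :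
    ‖(∫ s in (0 : ℝ)..1, (TrigApprox.jackson M (x - s) : ℂ) * f s) - f x‖
      ≤ 2 * (1 + π ^ 4 / 128) * K * ((M : ℝ) + 1) ^ (-α) := by
  have hK0 : 0 ≤ K := by
    have := hK 0 1
    rw [abs_one, Real.one_rpow, mul_one] at this
    exact (norm_nonneg _).trans this
  set J : ℝ → ℂ := fun t => (TrigApprox.jackson M t : ℂ) with hJ
  have hJc : Continuous J := Complex.continuous_ofReal.comp (TrigApprox.continuous_jackson M)
  -- recentre
  have hh : Function.Periodic (fun t => J t * f (x - t)) 1 := by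
    intro t
    simp only [hJ]
    rw [show x - (t + 1) = x - t - 1 by ring, hper.sub_eq]
    have := TrigApprox.jackson_add_int M t 1
    push_cast at this
    rw [this]
  have h1 : ∫ s in (0 : ℝ)..1, (TrigApprox.jackson M (x - s) : ℂ) * f s = ∫ t in (-(1 / 2) : ℝ)..(1 / 2), J t * f (x - t) := by
    rw [← integral_comp_sub_periodic hh x]
    refine intervalIntegral.integral_congr fun s _ => ?_
    simp only [hJ, sub_sub_cancel]
  -- `∫ J = 1`, so subtract `f x`
  have hiJf : IntervalIntegrable (fun t => J t * f (x - t)) volume (-(1 / 2)) (1 / 2) :=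
    (intervalIntegrable_reflect_sub' hper hint x _ _).continuousOn_mul hJc.continuousOn
  have hiJ : IntervalIntegrable (fun t => J t * f x) volume (-(1 / 2)) (1 / 2) :=
    (hJc.mul continuous_const).intervalIntegrable _ _
  have h2 : (∫ t in (-(1 / 2) : ℝ)..(1 / 2), J t * f (x - t)) - f x
      = ∫ t in (-(1 / 2) : ℝ)..(1 / 2), J t * (f (x - t) - f x) := by
    simp_rw [mul_sub]
    rw [intervalIntegral.integral_sub hiJf hiJ, intervalIntegral.integral_mul_const]
    simp only [hJ]
    rw [intervalIntegral.integral_ofReal, integral_jackson_symm]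
    push_cast
    ring
  rw [h1, h2]
  -- pointwise bound and integrate
  have hbound : IntervalIntegrable (fun t : ℝ => TrigApprox.jackson M t * (K * |t| ^ α)) volume (-(1 / 2)) (1 / 2) :=
    ((TrigApprox.continuous_jackson M).mul (continuous_const.mul
      ((Real.continuous_rpow_const hα0.le).comp continuous_abs))).intervalIntegrable _ _
  have h3 : ‖∫ t in (-(1 / 2) : ℝ)..(1 / 2), J t * (f (x - t) - f x)‖
      ≤ ∫ t in (-(1 / 2) : ℝ)..(1 / 2), TrigApprox.jackson M t * (K * |t| ^ α) := by
    refine intervalIntegral.norm_integral_le_of_norm_le (by norm_num) (Filter.Eventually.of_forall fun t _ => ?_)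
      hbound
    rw [norm_mul, hJ, Complex.norm_real, Real.norm_eq_abs, abs_of_nonneg (TrigApprox.jackson_nonneg M t)]
    refine mul_le_mul_of_nonneg_left ?_ (TrigApprox.jackson_nonneg M t)
    have := hK x (-t)
    rwa [← sub_eq_add_neg, abs_neg] at this
  refine h3.trans ?_
  -- fold the even integrand onto `[0, ½]`
  have hci : ∀ a b : ℝ, IntervalIntegrable (fun t : ℝ => TrigApprox.jackson M t * (K * |t| ^ α)) volume a b := fun a b =>
    ((TrigApprox.continuous_jackson M).mul (continuous_const.mul
      ((Real.continuous_rpow_const hα0.le).comp continuous_abs))).intervalIntegrable _ _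
  rw [← intervalIntegral.integral_add_adjacent_intervals (hci (-(1 / 2)) 0) (hci 0 (1 / 2))]
  have hrefl : ∫ t in (-(1 / 2) : ℝ)..0, TrigApprox.jackson M t * (K * |t| ^ α)
      = ∫ t in (0 : ℝ)..(1 / 2), TrigApprox.jackson M t * (K * |t| ^ α) := by
    have h0 := intervalIntegral.integral_comp_neg (a := (0 : ℝ)) (b := 1 / 2)
      (fun t => TrigApprox.jackson M t * (K * |t| ^ α))
    simp only [TrigApprox.jackson_neg, abs_neg, neg_zero] at h0
    exact h0.symm
  have hhalf : ∫ t in (0 : ℝ)..(1 / 2), TrigApprox.jackson M t * (K * |t| ^ α)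
      = K * ∫ t in (0 : ℝ)..(1 / 2), TrigApprox.jackson M t * t ^ α := by
    rw [← intervalIntegral.integral_const_mul]
    refine intervalIntegral.integral_congr fun t ht => ?_
    rw [Set.uIcc_of_le (by norm_num : (0 : ℝ) ≤ 1 / 2)] at ht
    rw [abs_of_nonneg ht.1]
    ring
  rw [hrefl, hhalf]
  have hmom := integral_jackson_mul_rpow_le M hα0 hα1
  have hI0 : 0 ≤ ∫ t in (0 : ℝ)..(1 / 2), TrigApprox.jackson M t * t ^ α :=
    intervalIntegral.integral_nonneg (by norm_num) fun t ht => mul_nonneg (TrigApprox.jackson_nonneg M t)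
      (Real.rpow_nonneg ht.1 _)
  nlinarith [mul_le_mul_of_nonneg_left hmom hK0]

/-- **Jackson's theorem for `Λ_α` (Zygmund III (13.14), `k = 0`: `f ∈ Λ_α ⟹ E_n[f] = O(n^{−α})`)**, explicit form:
for `f` as above and every `M` there is a trigonometric polynomial `T` of degree `2M` with
`sup|f − T| ≤ 2(1 + π⁴/128) K (M+1)^{−α}`. [cite: Zygmund2002, Vol. I, Ch. III §13, Theorem (13.14) ((13.15), `k = 0`)] -/
theorem exists_trigPoly_norm_sub_le_of_holder (hper : Function.Periodic f 1) (hint : IntervalIntegrable f volume 0 1)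
    {K α : ℝ} (hα0 : 0 < α) (hα1 : α ≤ 1) (hK : ∀ x t : ℝ, ‖f (x + t) - f x‖ ≤ K * |t| ^ α) (M : ℕ) :
    ∃ c : ℤ → ℂ, ∀ x : ℝ,
      ‖f x - ∑ k ∈ Icc (-((M + M : ℕ) : ℤ)) (M + M : ℕ), c k * TrigApprox.e (k * x)‖
        ≤ 2 * (1 + π ^ 4 / 128) * K * ((M : ℝ) + 1) ^ (-α) := by
  obtain ⟨c, hc⟩ := exists_trigPoly_jacksonMean M hint
  refine ⟨c, fun x => ?_⟩
  rw [← hc x, norm_sub_rev]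
  exact norm_jacksonMean_sub_le hper hint hα0 hα1 hK M x

end jackson

/-! ## § 4. Uniform convergence of `S_n[f]` for `f ∈ Λ_α` -/

section uniform

variable {f : ℝ → ℂ}

/-- `(2 + log(2n+1)) (⌊n/2⌋ + 1)^{−α} → 0` for `α > 0`. [folklore] -/
private theorem tendsto_log_mul_rpow_neg {α : ℝ} (hα0 : 0 < α) (C : ℝ) :
    Tendsto (fun n : ℕ => (2 + Real.log (2 * n + 1)) * (C * (((n / 2 : ℕ) : ℝ) + 1) ^ (-α))) atTop (𝓝 0) := by
  -- `x_n = 2n + 1 → ∞`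
  have hx : Tendsto (fun n : ℕ => 2 * (n : ℝ) + 1) atTop atTop :=
    tendsto_atTop_add_const_right _ 1 (Tendsto.const_mul_atTop two_pos tendsto_natCast_atTop_atTop)
  -- `log x / x^α → 0` and `x^{-α} → 0`
  have h1 : Tendsto (fun n : ℕ => Real.log (2 * (n : ℝ) + 1) / (2 * (n : ℝ) + 1) ^ α) atTop (𝓝 0) :=
    ((isLittleO_log_rpow_atTop hα0).tendsto_div_nhds_zero).comp hx
  have h2 : Tendsto (fun n : ℕ => (2 * (n : ℝ) + 1) ^ (-α)) atTop (𝓝 0) :=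
    (tendsto_rpow_neg_atTop hα0).comp hx
  -- comparison `(⌊n/2⌋ + 1)^{−α} ≤ 4^α (2n+1)^{−α}`
  have hcmp : ∀ n : ℕ, (((n / 2 : ℕ) : ℝ) + 1) ^ (-α) ≤ (4 : ℝ) ^ α * (2 * (n : ℝ) + 1) ^ (-α) := by
    intro n
    have hn : (2 * (n : ℝ) + 1) / 4 ≤ ((n / 2 : ℕ) : ℝ) + 1 := by
      have h : n ≤ n / 2 * 2 + 1 := by omega
      have h' : (n : ℝ) ≤ (n / 2 : ℕ) * 2 + 1 := by exact_mod_cast h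
      linarith
    have hpos : 0 < (2 * (n : ℝ) + 1) / 4 := by positivity
    calc (((n / 2 : ℕ) : ℝ) + 1) ^ (-α) ≤ ((2 * (n : ℝ) + 1) / 4) ^ (-α) :=
          Real.rpow_le_rpow_of_nonpos hpos hn (by linarith)
      _ = (4 : ℝ) ^ α * (2 * (n : ℝ) + 1) ^ (-α) := by
          rw [Real.div_rpow (by positivity) (by norm_num), Real.rpow_neg (by norm_num : (0 : ℝ) ≤ 4), div_eq_mul_inv,
            inv_inv, mul_comm]
  have hlim : Tendsto (fun n : ℕ => |C| * (4 : ℝ) ^ α * (2 * (2 * (n : ℝ) + 1) ^ (-α)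
      + Real.log (2 * (n : ℝ) + 1) / (2 * (n : ℝ) + 1) ^ α)) atTop (𝓝 0) := by
    have := ((h2.const_mul 2).add h1).const_mul (|C| * (4 : ℝ) ^ α)
    simpa using this
  refine squeeze_zero_norm (fun n => ?_) hlim
  have hx0 : 0 < 2 * (n : ℝ) + 1 := by positivity
  have hlog : 0 ≤ Real.log (2 * (n : ℝ) + 1) := Real.log_nonneg (by linarith)
  have hA : 0 ≤ 2 + Real.log (2 * (n : ℝ) + 1) := by linarith
  rw [norm_mul, norm_mul, Real.norm_eq_abs, Real.norm_eq_abs, Real.norm_eq_abs, abs_of_nonneg hA,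
    abs_of_nonneg (Real.rpow_nonneg (by positivity) _)]
  have hdiv : Real.log (2 * (n : ℝ) + 1) / (2 * (n : ℝ) + 1) ^ α = Real.log (2 * (n : ℝ) + 1) * (2 * (n : ℝ) + 1) ^ (-α) := by
    rw [Real.rpow_neg hx0.le, div_eq_mul_inv]
  rw [hdiv]
  have h4 : 0 ≤ (4 : ℝ) ^ α := by positivity
  have hr : 0 ≤ (2 * (n : ℝ) + 1) ^ (-α) := by positivity
  calc (2 + Real.log (2 * (n : ℝ) + 1)) * (|C| * (((n / 2 : ℕ) : ℝ) + 1) ^ (-α))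
      ≤ (2 + Real.log (2 * (n : ℝ) + 1)) * (|C| * ((4 : ℝ) ^ α * (2 * (n : ℝ) + 1) ^ (-α))) :=
        mul_le_mul_of_nonneg_left (mul_le_mul_of_nonneg_left (hcmp n) (abs_nonneg C)) hA
    _ = |C| * (4 : ℝ) ^ α * (2 * (2 * (n : ℝ) + 1) ^ (-α) + Real.log (2 * (n : ℝ) + 1) * (2 * (n : ℝ) + 1) ^ (-α)) := by
        ring

/-- **Uniform convergence of `S_n[f]` for `f ∈ Λ_α`** (Zygmund II (10.3) for the classes `Λ_α`, via III (13.14) and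
(13.25)): if `f` is `1`-periodic, integrable over a period and `|f(x + t) − f(x)| ≤ K|t|^α` (`0 < α ≤ 1`), then
`S_n(f, ·) → f` uniformly on `ℝ`. [cite: Zygmund2002, Vol. I, Ch. II §10, Theorem (10.3); Ch. III §13, (13.25) with
(13.14)] -/
theorem tendstoUniformly_partialSum_of_holder (hper : Function.Periodic f 1) (hint : IntervalIntegrable f volume 0 1)
    {K α : ℝ} (hα0 : 0 < α) (hα1 : α ≤ 1) (hK : ∀ x t : ℝ, ‖f (x + t) - f x‖ ≤ K * |t| ^ α) :
    TendstoUniformly (fun (n : ℕ) (x : ℝ) => ∑ j ∈ Icc (-(n : ℤ)) n, fourierCoeffOn zero_lt_one f j * TrigApprox.e (j * x))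
      f atTop := by
  choose c hc using fun M : ℕ => exists_trigPoly_norm_sub_le_of_holder hper hint hα0 hα1 hK M
  refine tendstoUniformly_partialSum_of_trigPoly_approx hper hint (fun n => n / 2 + n / 2) (fun n => by omega)
    (fun n => c (n / 2)) (fun n => 2 * (1 + π ^ 4 / 128) * K * (((n / 2 : ℕ) : ℝ) + 1) ^ (-α))
    (fun n x => hc (n / 2) x) ?_
  have h := tendsto_log_mul_rpow_neg hα0 (2 * (1 + π ^ 4 / 128) * K)
  refine h.congr fun n => ?_
  ring

end uniform

end Literature.Analysis.Fourier
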